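import Mathlib
import HarnessLib
import HarnessLib.Audit.Tags

/-!
# HodgeLocusCensusResidueLength — the graded pieces are vector spaces: `R`-length = `k`-dimension

HONEST FRAMING (verbatim, pub-hlocus cell): certified instances and evidence bearing on the general
Hodge conjecture; no claim.

DICTIONARY (companion of `HodgeLocusCensusLengthFiltration`): the engines print the Hilbert function
of the tangent cone as DIMENSIONS over the ground field `k` (= residue field of the slice germ) of the
graded pieces `𝔪^i S ⧸ 𝔪^(i+1) S`, which are `k`-vector spaces; `HodgeLocusCensusLengthFiltration`
sums their `R`-LENGTHS.  This module checks the bridge: for a module `V` over a local ring `R` carrying a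
compatible structure of vector space over the residue field `k = R ⧸ 𝔪` (i.e. `𝔪 V = 0`), the
`R`-length of `V` equals its `k`-dimension.

What the kernel checks (Mathlib only, no definitions):
* `length_eq_length_residueField` — `length_R V = length_k V` (Mathlib `Module.length_eq_of_surjective`
  for the surjection `R → k`).
* `length_eq_finrank_residueField` — for `V` finite-dimensional over `k`: `length_R V = dim_k V`.
NOT formalised: the engines' computation of these dimensions, and all Hodge theory.
-/

namespace Summit.HodgeConjecture.HodgeConjecture.HodgeLocus.Census

open IsLocalRing

variable {R : Type*} [CommRing R] [IsLocalRing R]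
variable (V : Type*) [AddCommGroup V] [Module R V] [Module (ResidueField R) V]
  [IsScalarTower R (ResidueField R) V]

/-- Over a local ring, a module that is a vector space over the residue field (compatibly) has the
same length over `R` as over `k`. -/
theorem length_eq_length_residueField :
    Module.length R V = Module.length (ResidueField R) V :=
  Module.length_eq_of_surjective (S := R) (R := ResidueField R) (M := V)
    (by
      change Function.Surjective (Ideal.Quotient.mk (maximalIdeal R))
      exact Ideal.Quotient.mk_surjective)

/-- … and for a finite-dimensional one, the `R`-length is the `k`-dimension (the number the engines
print as a Hilbert-function value). -/
theorem length_eq_finrank_residueField [Module.Finite (ResidueField R) V] :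
    Module.length R V = Module.finrank (ResidueField R) V := by
  rw [length_eq_length_residueField V]
  exact Module.length_eq_finrank (ResidueField R) V

end Summit.HodgeConjecture.HodgeConjecture.HodgeLocus.Census
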